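/-
Copyright (c) 2026 the pub-hodgecm-mathlib formalisation cell (harness21).  Prover seat hodgecm-mathlib-F0P3a-p04 (g12); «(i) p04» of F0P3b-p01 (g6) 2026-09-01 06:38:27Z
(the (F12)-side half of «…FrameAtInertPlace»); architect A-p06 (g26) ED. 1.5 «TYPE-(1) VALUE STUBS»; LEAD F0P3a-plan (g9).
-/
import Literature.NumberTheory.Automorphic.FixedCosetsTransport                              -- ★ p841708∕p841731 (F0P3-p02): `#Fix_{G′∕K′}(t) = #{q | e (ψ t) • q = q}`
import Literature.NumberTheory.Automorphic.UnitaryUnitOrbitalIntegralFixedPoints              -- ★ the `G′_v` socket `Φ(⟦γ⟧, 1_{K′}) = #Fix_γ`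
import Literature.NumberTheory.Automorphic.UnitaryEllipticCentralizerCompactNonsplit          -- ★ (E4) compact centralisers from a norm-one eigenframe
import HarnessLib

/-!
# The unit orbital integral of a class in `G′_v` READ IN THE ONE-PLACE MODEL through a level-preserving congruence — the (F12)-side half of the value stubs
# (Rogawski 1990 §14.2 p. 233 «`K_v ≃ K′_v`», §4.9 Prop. 4.9.1 (b); Flicker 1998 §3 Prop. 5; Laumon 1995 Lemma 5.3.2)

Topic `NumberTheory/Rogawski1990`; namespace `Literature.NumberTheory.Rogawski1990`.  THEOREMS ONLY (no definition, no instance, no notation, no named fact, no `sorry`);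
kernel lane.  Cell `pub/hodgecm-mathlib`, crux H413 = `stmt-HodgeConjecture-24833`, road «D-N7-inert», line «N7nsCount» ED. 1.5: the four type-(1) VALUE STUBS
`stub_splitGValue1…4` (fragment `N7nsCount.ed1p5.splitvalues.fragment.lean`, p04) read `Φ(⟦t⟧, 1_{K′}) = ↑Xᵢ` for ANY `t ∈ G′_v = U(H′)(L⁺_v)` carried to Flicker's `i`-th
literal by a LEVEL-PRESERVING congruence `ψ : G′_v ≃ U(Φ₃)(L⁺_v)`; their payment splits into (i) THIS FILE — the (F12)-side half, value-agnostic and literal-agnostic: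
**`classOrbitalIntegral_indicator_eq_natCard_fixedPoints_of_congr`**: for canonical `mG`, `νG(K′) = 1`, and `t` with an eigenframe over `E_v` of pairwise distinct NORM-ONE
eigenvalues (the anisotropic torus `(L_w¹)³`: `t` is regular — `χ_t = ∏ (X − uᵢ)` separable — and `Z(t)` is compact, ★ (E4)),
`Φ(⟦t⟧, 1_{K′}) = ↑ #{q ∈ U_w ⧸ unitaryInt : e(ψ t) • q = q}`, `e = localNonsplitEquiv_{Φ₃}` (★ `G′_v` socket `…_eq_natCard_fixedBy` ∘ ★ F0P3-p02
`natCard_fixedBy_cmLocalIntegralLevel_eq_of_congr`), and (ii) F0P3b-p01's corner count `#{q | τ • q = q} = phi…` at the literal in `U(L_w)` (Prop. 5 + LAYER B∕C).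
The eigenframe of `t` comes for free from the literal (★ `flickerTorusElt_mul_frame` transported by `Tl⁻¹`).  HONEST LABEL: HC_CM is proved only modulo the printed
citations until rung 0 closes; this file proves bookkeeping, not a count.

## References
* [Rogawski1990] J. D. Rogawski, *Automorphic Representations of Unitary Groups in Three Variables* (1990), §14.2 p. 233, §4.9 Prop. 4.9.1 (b) p. 55, §3.6 pp. 31–32.
* [Flicker1998UnitaryFL] Y. Z. Flicker, *Elementary proof of the fundamental lemma for a unitary group*, Canad. J. Math. 50 (1998), §3 Prop. 5 p. 82.
* [Laumon1995] G. Laumon, *Cohomology of Drinfeld modular varieties I* (1995), Lemma (5.3.2) p. 136.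
-/

set_option autoImplicit false

noncomputable section

open MeasureTheory Measure NumberField IsDedekindDomain Matrix Polynomial
open scoped MatrixGroups Pointwise

namespace Literature.NumberTheory.Rogawski1990

open Literature.NumberTheory.Automorphic Literature.NumberTheory.Automorphic.UnitaryGroup
open Literature.NumberTheory.Automorphic.HermitianLattice (unitaryInt)

section OfCongr

variable (L : Type) [Field L] [NumberField L] [IsCMField L] (H' : Matrix (Fin 3) (Fin 3) L) {v : HeightOneSpectrum (𝓞 ↥(maximalRealSubfield L))}

/-- **An element with an eigenframe of pairwise distinct eigenvalues is regular** (`χ_t = χ_{diag(u)} = ∏ (X − uᵢ)` is separable; at a non-split `v`, where `E_v = L_w` is a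
field). [cite: Rogawski1990, §3.6 p. 31] -/
theorem isRegularElt_of_eigenframe (w : PlacesOver L v) (hw : IsCMField.complexConj L • w.1 = w.1) (t : (cmDatum L 3 H').Local v)
    {Q : GL (Fin 3) (LocalRing L v)} {u : Fin 3 → LocalRing L v}
    (hQ : (t.val.val : Matrix (Fin 3) (Fin 3) (LocalRing L v)) * Q.val = Q.val * diagonal u) (hu : Function.Injective u) :
    IsRegularElt (t.val : GL (Fin 3) (LocalRing L v)) := by
  letI : Field (LocalRing L v) :=
    (LocalRing.isField_of_smul_eq (IsCMField.complexConj L) (IsCMField.complexConj_ne_one L) w hw).toField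
  have hdQ : IsUnit (Q.val : Matrix (Fin 3) (Fin 3) (LocalRing L v)).det := (Matrix.isUnits_det_units Q)
  have ht : (t.val.val : Matrix (Fin 3) (Fin 3) (LocalRing L v)) = Q.val * diagonal u * Q.val⁻¹ := by
    rw [← hQ, Matrix.mul_assoc, Matrix.mul_nonsing_inv _ hdQ, Matrix.mul_one]
  rw [isRegularElt_iff, ht, Matrix.charpoly_units_conj, Matrix.charpoly_diagonal]
  exact Polynomial.separable_prod_X_sub_C_iff.2 hu

set_option synthInstance.maxHeartbeats 200000 in  -- the coset action `U_w ↷ U_w ⧸ unitaryInt` (as in ★ `FixedCosetsTransport`)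
open scoped Classical in
/-- **THE (F12)-SIDE HALF OF THE VALUE STUBS**: at a non-split place, for `H′` hermitian invertible, a canonical orbital-measure family `mG` on `G′_v = U(H′)(L⁺_v)` with
`νG(K′) = 1`, a level-preserving congruence `ψ : G′_v ≃ U(Φ₃)(L⁺_v)` (`g ∈ K′ ↔ ψ g ∈ K_Φ`; ★ `exists_four_matched_flicker_representatives` delivers one), and `t ∈ G′_v`
with an eigenframe of pairwise distinct NORM-ONE eigenvalues over `E_v` (so `t` is regular elliptic and `Z(t)` is compact):
`Φ(⟦t⟧, 1_{K′}) = ↑ #{q ∈ U(σ_w, Φ₃)(L_w) ⧸ unitaryInt : (localNonsplitEquiv (ψ t)) • q = q}` — the orbital integral read as a fixed-coset count in the ONE-PLACE MODEL,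
where Flicker's Prop. 5 and the corner counts live (`(localNonsplitEquiv (ψ t)).val.val = (ψ t).val.val.map ev_w`, ★ `coe_coe_localNonsplitEquiv_apply`).
[cite: Rogawski1990, §14.2 p. 233; §4.9 Prop. 4.9.1 (b) p. 55] [cite: Flicker1998UnitaryFL, §3 Prop. 5 p. 82] [cite: Laumon1995, Lemma (5.3.2) p. 136] -/
theorem classOrbitalIntegral_indicator_eq_natCard_fixedPoints_of_congr
    (hH' : (H'.map (IsCMField.complexConj L))ᵀ = H') (hH'u : IsUnit H')
    (w : PlacesOver L v) (hw : IsCMField.complexConj L • w.1 = w.1)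
    [MeasurableSpace ((cmDatum L 3 H').Local v)] [BorelSpace ((cmDatum L 3 H').Local v)]
    [∀ γ : ((cmDatum L 3 H').Local v), MeasurableSpace (((cmDatum L 3 H').Local v) ⧸ Subgroup.centralizer ({γ} : Set ((cmDatum L 3 H').Local v)))]
    [∀ γ : ((cmDatum L 3 H').Local v), BorelSpace (((cmDatum L 3 H').Local v) ⧸ Subgroup.centralizer ({γ} : Set ((cmDatum L 3 H').Local v)))]
    (νG : Measure ((cmDatum L 3 H').Local v)) [νG.IsHaarMeasure] [νG.IsMulRightInvariant]
    {mG : OrbitalMeasureFamily ((cmDatum L 3 H').Local v)}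
    (hmG : mG.IsCanonical (fun γ => IsRegularElt (γ.val : GL (Fin 3) (UnitaryGroup.LocalRing L v))) νG)
    (hνG : νG (cmLocalIntegralLevel L 3 H' v : Set ((cmDatum L 3 H').Local v)) = 1)
    (ψ : ↥(UnitaryGroup.«local» L (IsCMField.complexConj L) 3 H' v) ≃ₜ*
        ↥(UnitaryGroup.«local» L (IsCMField.complexConj L) 3 (Matrix.of fun i j : Fin 3 => if i.val + j.val + 1 = 3 then (1 : L) else 0) v))
    (hlev : ∀ g, g ∈ cmLocalIntegralLevel L 3 H' v ↔
        ψ g ∈ cmLocalIntegralLevel L 3 (Matrix.of fun i j : Fin 3 => if i.val + j.val + 1 = 3 then (1 : L) else 0) v)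
    (t : (cmDatum L 3 H').Local v) {Q : GL (Fin 3) (LocalRing L v)} {u : Fin 3 → LocalRing L v}
    (hQ : (t.val.val : Matrix (Fin 3) (Fin 3) (LocalRing L v)) * Q.val = Q.val * diagonal u) (hu : Function.Injective u)
    (hu1 : ∀ i, conjLocal L (IsCMField.complexConj L) v (u i) * u i = 1) :
    classOrbitalIntegral mG ((cmLocalIntegralLevel L 3 H' v : Set ((cmDatum L 3 H').Local v)).indicator fun _ => (1 : ℂ)) (ConjClasses.mk t) =
      (Nat.card {q : ↥(unitaryGroupOfForm (galAdicCompletionMap (L := L) (IsCMField.complexConj L) hw)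
          (placeForm (Matrix.of fun i j : Fin 3 => if i.val + j.val + 1 = 3 then (1 : L) else 0) w.1)) ⧸
        unitaryInt (galAdicCompletionMap (L := L) (IsCMField.complexConj L) hw)
          (placeForm (Matrix.of fun i j : Fin 3 => if i.val + j.val + 1 = 3 then (1 : L) else 0) w.1) |
        localNonsplitEquiv (IsCMField.complexConj L) (Matrix.of fun i j : Fin 3 => if i.val + j.val + 1 = 3 then (1 : L) else 0)
          (IsCMField.complexConj_ne_one L) w hw (ψ t) • q = q} : ℂ) := by
  -- hermitian data in the `cmConjRingHom` spelling of the socket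
  have hH'c : (H'.map (cmConjRingHom L))ᵀ = H' := by
    have e1 : H'.map (cmConjRingHom L) = H'.map (IsCMField.complexConj L) := by
      ext i j; simp [Matrix.map_apply, cmConjRingHom_apply]
    rw [e1]; exact hH'
  have hdet : H'.det ≠ 0 := (Matrix.isUnit_iff_isUnit_det _ |>.1 hH'u).ne_zero
  -- regularity and compactness of the centraliser from the eigenframe
  have hreg : IsRegularElt (t.val : GL (Fin 3) (LocalRing L v)) := isRegularElt_of_eigenframe L H' w hw t hQ hu
  haveI : CompactSpace (Subgroup.centralizer ({t} : Set ((cmDatum L 3 H').Local v))) :=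
    compactSpace_centralizer_of_eigenframe_of_smul_eq L w hw H' hH'c hdet t hQ hu hu1
  rw [classOrbitalIntegral_indicator_complex_cmLocalIntegralLevel_eq_natCard_fixedBy L 3 H' v νG hH'c hdet hmG hνG t hreg,
    natCard_fixedBy_cmLocalIntegralLevel_eq_of_congr L H' w hw ψ hlev t]

end OfCongr

end Literature.NumberTheory.Rogawski1990

end
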